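import Summits.Ventures.LatticeQCDFlow.Scaling.BooleanStarDisagreementPotential

/-!
HONEST FRAMING: exact (Metropolis-corrected) sampling algorithms for lattice gauge theory; figures
of merit are autocorrelation/cost numbers at stated couplings and volumes; no continuum-physics
claim.

# BooleanStarDisagreementDrift — THE ONE-STEP CONTRACTION: UNDER THE SYNCHRONOUS COUPLING OF THE BOOLEAN STAR
# `E[Φ(X',Y') | (x,y)] ≤ (1 − λ)·Φ(x,y)`, `λ = min{(1−θ)·a·c·t/m, ((1−t)w_0·θ − (1−θ)t)/(K+θ)}` — ANY HUB LIST WITH MULTIPLICITIES `≥ c`,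
# ANY COLD KERNELS, NO CONDITION ON THE REPLICA LAWS (lean-2 GEN-30, ours)

Venture-side (OURS).  Cell `lqcd-flow` (pub-lqcd), unit `pub-lqcd-lean-2-g30`, 2026-08-28.  Chapter P (OPEN-MATH-chapterM item 1 on
the two-point family), file 3.  Setting of files 1–2.  `a ≥ 0` is a lower bound for the acceptance `α_r(z)` of every entry swap between UNEQUAL
contents (`z_0 ≠ z_l`); `0 < θ ≤ 1` with `(1−θ)t ≤ (1−t)w_0·θ` (e.g. `θ = 2t/(2t+h)`, `h = (1−t)w_0`, file 4).

## What is proved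

* §7 `sum_ite_and_mul`, `sum_mixture_mul`, `syncSwap_sum_potential` (the entry part of `E Φ'` in four-outcome form),
  **`syncUpdate_sum_potential_le`** (the update part at level `k` is `≤ Φ − 𝟙{k=0}·θ·𝟙{x_0 ≠ y_0}`: the common hot draw kills a hub
  disagreement, cold moves cannot raise the count), `sum_entries_disagree_ge` (`Σ_r 𝟙{x_{l_r} ≠ y_{l_r}} ≥ c·#{cold disagreements}`), and
  **`boolSync_step_potential_le`** — **`Σ_b Q((x,y),b)·Φ(b) ≤ (1 − λ)·Φ(x,y)`** for every pair: hubs agree ⇒ every cold disagreement is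
  offered to the hub at rate `≥ ct/m`, accepted with probability `≥ a`, and then worth `θ` instead of `1` (drift `≤ −(1−θ)act/m·Φ`); hubs
  differ ⇒ the hub disagreement escapes to an agreeing cold level at rate `≤ t` (gain `1−θ`) and dies at the redraw (rate `(1−t)w_0`,
  loss `θ`), net `≤ −((1−t)w_0θ − (1−θ)t) ≤ −λ(K+θ) ≤ −λΦ`.

Reading (no numerics implied): a Foster–Lyapunov contraction for the COUPLED chain with a rate free of the replica laws — the two-point
analogue of what no tag chain, pattern or split chain could certify for general `S` (OPEN-MATH-chapterM, GEN-28 addendum).  NOT CLAIMED: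
general `S`.  Literature grade (cell rule): OWN; nothing cited; no new bib keys.
-/

noncomputable section

open Finset Function
open Literature.Probability.MarkovChains

namespace Summit.Ventures.LatticeQCDFlow.Scaling

variable {K m : ℕ} {μ : Fin (K + 1) → Bool → ℝ} {M : Fin (K + 1) → Bool → Bool → ℝ} {w : Fin (K + 1) → ℝ} {t : ℝ}

section Step
variable (κ : Fin m → Fin K)

/-! ## §7 The one-step contraction of the potential -/

/-- `Σ_b 𝟙{b = (A,B)}·Φ(b) = Φ(A,B)`. [ours] -/
theorem sum_ite_and_mul {X : Type*} [Fintype X] [DecidableEq X] (A B : X) (Φ : X × X → ℝ) :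
    ∑ b : X × X, (if b.1 = A ∧ b.2 = B then (1 : ℝ) else 0) * Φ b = Φ (A, B) := by
  rw [Finset.sum_eq_single (A, B)]
  · simp
  · rintro b - hb
    rw [if_neg, zero_mul]
    rintro ⟨h1, h2⟩
    exact hb (Prod.ext h1 h2)
  · intro h; exact absurd (mem_univ _) h

/-- `Σ_x (Σ_i c_i F_i(x))·g(x) = Σ_i c_i Σ_x F_i(x) g(x)`. [ours] -/
theorem sum_mixture_mul {ι X : Type*} [Fintype ι] [Fintype X] (c : ι → ℝ) (F : ι → X → ℝ) (g : X → ℝ) :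
    ∑ x, (∑ i, c i * F i x) * g x = ∑ i, c i * ∑ x, F i x * g x := by
  simp_rw [Finset.sum_mul, Finset.mul_sum, mul_assoc]
  exact Finset.sum_comm

/-- The expected potential after the coupled entry move, in the four-outcome form. [ours] -/
theorem syncSwap_sum_potential (αx αy : ℝ) (x y yx yy : Fin (K + 1) → Bool)
    (Φ : (Fin (K + 1) → Bool) × (Fin (K + 1) → Bool) → ℝ) :
    ∑ b : (Fin (K + 1) → Bool) × (Fin (K + 1) → Bool),
        (min αx αy * (if b.1 = yx ∧ b.2 = yy then (1 : ℝ) else 0)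
          + (αx - min αx αy) * (if b.1 = yx ∧ b.2 = y then (1 : ℝ) else 0)
          + (αy - min αx αy) * (if b.1 = x ∧ b.2 = yy then (1 : ℝ) else 0)
          + (1 - αx - αy + min αx αy) * (if b.1 = x ∧ b.2 = y then (1 : ℝ) else 0)) * Φ b
      = min αx αy * Φ (yx, yy) + (αx - min αx αy) * Φ (yx, y) + (αy - min αx αy) * Φ (x, yy)
        + (1 - αx - αy + min αx αy) * Φ (x, y) := by
  simp_rw [add_mul, mul_assoc, Finset.sum_add_distrib, ← Finset.mul_sum, sum_ite_and_mul]

/-- **The expected potential after the coupled update at level `k` is at most `Φ − c_k·𝟙{k = 0}·𝟙{x_0 ≠ y_0}`:** the common hot draw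
kills a hub disagreement, a common cold move at an agreeing level keeps agreement, independent cold moves at a disagreeing level
cannot raise the count (`M_k` row-stochastic). [ours] -/
theorem syncUpdate_sum_potential_le (hM : ∀ k, IsRowStochastic (M k)) {θ : ℝ}
    {Φ : (Fin (K + 1) → Bool) × (Fin (K + 1) → Bool) → ℝ}
    (hΦ : ∀ a, Φ a = ∑ k : Fin (K + 1), (if k = 0 then θ else 1) * (if a.1 k = a.2 k then (0 : ℝ) else 1))
    (k : Fin (K + 1)) (x y : Fin (K + 1) → Bool) :
    ∑ b : (Fin (K + 1) → Bool) × (Fin (K + 1) → Bool),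
        (if x k = y k ∨ k = 0 then
            ∑ v : Bool, M k (x k) v * (if b.1 = update x k v ∧ b.2 = update y k v then (1 : ℝ) else 0)
          else coordKernel M k x b.1 * coordKernel M k y b.2) * Φ b
      ≤ Φ (x, y) - (if k = 0 then θ * (if x 0 = y 0 then (0 : ℝ) else 1) else 0) := by
  by_cases h : x k = y k ∨ k = 0
  · simp only [h, if_true]
    rw [sum_mixture_mul]
    simp_rw [sum_ite_and_mul]
    have hval : ∀ v : Bool, Φ (update x k v, update y k v)
        = Φ (x, y) - (if k = 0 then θ * (if x 0 = y 0 then (0 : ℝ) else 1) else 0) := by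
      intro v
      have hloc := potential_local_single hΦ k (x := x) (y := y) (x' := update x k v) (y' := update y k v)
        fun j hj => ⟨update_of_ne hj _ _, update_of_ne hj _ _⟩
      rw [update_self, update_self, if_pos rfl] at hloc
      rw [hloc]
      rcases h with h | h
      · by_cases hk : k = 0
        · subst hk; rw [if_pos rfl, if_pos rfl, h, if_pos rfl]; ring
        · rw [if_neg hk, if_neg hk, if_pos h]; ring
      · subst h; rw [if_pos rfl, if_pos rfl]; ring
    simp_rw [hval]
    rw [← Finset.sum_mul, (hM k).2, one_mul]
  · simp only [h, if_false]
    rw [not_or] at h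
    rw [if_neg h.2, sub_zero, Fintype.sum_prod_type]
    simp_rw [mul_assoc, ← Finset.mul_sum]
    rw [sum_coordKernel_mul M k x (fun u => ∑ b2, coordKernel M k y b2 * Φ (u, b2))]
    rw [Finset.sum_congr rfl fun u _ => by rw [sum_coordKernel_mul M k y (fun v => Φ (update x k u, v))]]
    have hval : ∀ u v : Bool, Φ (update x k u, update y k v) ≤ Φ (x, y) := by
      intro u v
      have hloc := potential_local_single hΦ k (x := x) (y := y) (x' := update x k u) (y' := update y k v)
        fun j hj => ⟨update_of_ne hj _ _, update_of_ne hj _ _⟩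
      rw [update_self, update_self, if_neg h.2, if_neg h.1] at hloc
      rw [hloc]; split_ifs <;> linarith
    calc ∑ u, M k (x k) u * ∑ v, M k (y k) v * Φ (update x k u, update y k v)
        ≤ ∑ u, M k (x k) u * ∑ v, M k (y k) v * Φ (x, y) :=
          sum_le_sum fun u _ => mul_le_mul_of_nonneg_left
            (sum_le_sum fun v _ => mul_le_mul_of_nonneg_left (hval u v) ((hM k).1 _ _)) ((hM k).1 _ _)
      _ = Φ (x, y) := by rw [← Finset.sum_mul, (hM k).2, one_mul, ← Finset.sum_mul, (hM k).2, one_mul]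

/-- **Listed `≥ c` times:** `Σ_r 𝟙{x_{κ_r+1} ≠ y_{κ_r+1}} ≥ c·#{cold levels where x and y differ}`. [ours] -/
theorem sum_entries_disagree_ge {c : ℕ} (hc : ∀ p' : Fin K, c ≤ (univ.filter (fun r : Fin m => κ r = p')).card)
    (x y : Fin (K + 1) → Bool) :
    (c : ℝ) * ∑ j : Fin K, (if x j.succ = y j.succ then (0 : ℝ) else 1)
      ≤ ∑ r : Fin m, (if x (κ r).succ = y (κ r).succ then (0 : ℝ) else 1) := by
  rw [← Finset.sum_fiberwise univ κ (fun r : Fin m => if x (κ r).succ = y (κ r).succ then (0 : ℝ) else 1), Finset.mul_sum]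
  refine sum_le_sum fun j _ => ?_
  rw [Finset.sum_congr rfl fun r hr => by rw [(Finset.mem_filter.mp hr).2], sum_const, nsmul_eq_mul]
  exact mul_le_mul_of_nonneg_right (by exact_mod_cast hc j) (by split_ifs <;> norm_num)

/-- **THE ONE-STEP CONTRACTION OF THE DISAGREEMENT POTENTIAL.**  Boolean star (two-point replicas, identity entry maps, exact hot
redraws, row-stochastic cold kernels, hub list with multiplicities `≥ c`), synchronous coupling `Q`, potential
`Φ(x,y) = θ·𝟙{x_0 ≠ y_0} + #{cold disagreements}` with `0 < θ ≤ 1` and `(1−θ)t ≤ (1−t)w_0·θ`, least unequal-content acceptance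
`a ≥ 0`: **`Σ_b Q(a,b)Φ(b) ≤ (1 − λ)·Φ(a)`, `λ = min{(1−θ)·a·c·t/m, ((1−t)w_0·θ − (1−θ)t)/(K+θ)}`.**  (Hubs agree: every cold
disagreement is offered to the hub at rate `≥ ct/m` and accepted with probability `≥ a`, after which it is worth `θ` instead of `1`;
hubs differ: the hub disagreement escapes to an agreeing cold level at rate `≤ t`, gaining `1 − θ`, and dies at the redraw, rate
`(1−t)w_0`, losing `θ`.) [ours] -/
theorem boolSync_step_potential_le (hm : 1 ≤ m) (ht0 : 0 ≤ t) (ht1 : t ≤ 1) (hw0 : ∀ k, 0 ≤ w k) (hw1 : ∑ k, w k = 1)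
    (hμ : ∀ k x, 0 < μ k x) (hM : ∀ k, IsRowStochastic (M k)) {θ a : ℝ} (hθ0 : 0 < θ) (hθ1 : θ ≤ 1) (ha0 : 0 ≤ a)
    (hreg : (1 - θ) * t ≤ (1 - t) * w 0 * θ)
    {c : ℕ} (hc : ∀ p' : Fin K, c ≤ (univ.filter (fun r : Fin m => κ r = p')).card)
    {α : Fin m → (Fin (K + 1) → Bool) → ℝ}
    (hα : ∀ r z, α r z = min 1 (tensorFun μ (edgeFlowSwap (Equiv.refl Bool) 0 (κ r).succ z) / tensorFun μ z))
    (ha : ∀ r z, z 0 ≠ z (κ r).succ → a ≤ α r z)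
    {Φ : (Fin (K + 1) → Bool) × (Fin (K + 1) → Bool) → ℝ}
    (hΦ : ∀ a, Φ a = ∑ k : Fin (K + 1), (if k = 0 then θ else 1) * (if a.1 k = a.2 k then (0 : ℝ) else 1))
    {Q : (Fin (K + 1) → Bool) × (Fin (K + 1) → Bool) → (Fin (K + 1) → Bool) × (Fin (K + 1) → Bool) → ℝ}
    (hQ : ∀ a b, Q a b =
      ∑ r : Fin m, t / m *
        (min (α r a.1) (α r a.2) * (if b.1 = edgeFlowSwap (Equiv.refl Bool) 0 (κ r).succ a.1
              ∧ b.2 = edgeFlowSwap (Equiv.refl Bool) 0 (κ r).succ a.2 then (1 : ℝ) else 0)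
          + (α r a.1 - min (α r a.1) (α r a.2)) * (if b.1 = edgeFlowSwap (Equiv.refl Bool) 0 (κ r).succ a.1 ∧ b.2 = a.2
              then (1 : ℝ) else 0)
          + (α r a.2 - min (α r a.1) (α r a.2)) * (if b.1 = a.1 ∧ b.2 = edgeFlowSwap (Equiv.refl Bool) 0 (κ r).succ a.2
              then (1 : ℝ) else 0)
          + (1 - α r a.1 - α r a.2 + min (α r a.1) (α r a.2)) * (if b.1 = a.1 ∧ b.2 = a.2 then (1 : ℝ) else 0))
      + (1 - t) * ∑ k : Fin (K + 1), w k *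
        (if a.1 k = a.2 k ∨ k = 0 then
            ∑ v : Bool, M k (a.1 k) v * (if b.1 = update a.1 k v ∧ b.2 = update a.2 k v then (1 : ℝ) else 0)
          else coordKernel M k a.1 b.1 * coordKernel M k a.2 b.2))
    (a' : (Fin (K + 1) → Bool) × (Fin (K + 1) → Bool)) :
    ∑ b, Q a' b * Φ b
      ≤ (1 - min ((1 - θ) * a * c * t / m) (((1 - t) * w 0 * θ - (1 - θ) * t) / (K + θ))) * Φ a' := by
  obtain ⟨x, y⟩ := a'
  have hmpos : (0 : ℝ) < m := Nat.cast_pos.mpr (by omega)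
  have hΦ0 := potential_nonneg hθ0.le hΦ (x, y)
  have hΦK := potential_le hθ0.le hΦ x y
  have hhub := potential_eq_hub_add_cold hΦ x y
  set lam := min ((1 - θ) * a * c * t / m) (((1 - t) * w 0 * θ - (1 - θ) * t) / (K + θ)) with hlam
  have hlam0 : 0 ≤ lam := le_min (by positivity) (div_nonneg (by linarith) (by positivity))
  -- abbreviations for the entry and update parts of the expected potential
  set Sw : Fin m → ℝ := fun r =>
      min (α r x) (α r y) * Φ (edgeFlowSwap (Equiv.refl Bool) 0 (κ r).succ x, edgeFlowSwap (Equiv.refl Bool) 0 (κ r).succ y)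
        + (α r x - min (α r x) (α r y)) * Φ (edgeFlowSwap (Equiv.refl Bool) 0 (κ r).succ x, y)
        + (α r y - min (α r x) (α r y)) * Φ (x, edgeFlowSwap (Equiv.refl Bool) 0 (κ r).succ y)
        + (1 - α r x - α r y + min (α r x) (α r y)) * Φ (x, y) with hSw
  set Up : Fin (K + 1) → ℝ := fun k => ∑ b : (Fin (K + 1) → Bool) × (Fin (K + 1) → Bool),
      (if x k = y k ∨ k = 0 then
          ∑ v : Bool, M k (x k) v * (if b.1 = update x k v ∧ b.2 = update y k v then (1 : ℝ) else 0)
        else coordKernel M k x b.1 * coordKernel M k y b.2) * Φ b with hUp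
  -- split the expectation into the entry part and the update part
  have hexp : ∑ b, Q (x, y) b * Φ b = ∑ r : Fin m, t / m * Sw r + ∑ k : Fin (K + 1), ((1 - t) * w k) * Up k := by
    have hsplit : ∑ b, Q (x, y) b * Φ b
        = ∑ b : (Fin (K + 1) → Bool) × (Fin (K + 1) → Bool), (∑ r : Fin m, t / m *
            (min (α r x) (α r y) * (if b.1 = edgeFlowSwap (Equiv.refl Bool) 0 (κ r).succ x
                  ∧ b.2 = edgeFlowSwap (Equiv.refl Bool) 0 (κ r).succ y then (1 : ℝ) else 0)
              + (α r x - min (α r x) (α r y)) * (if b.1 = edgeFlowSwap (Equiv.refl Bool) 0 (κ r).succ x ∧ b.2 = y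
                  then (1 : ℝ) else 0)
              + (α r y - min (α r x) (α r y)) * (if b.1 = x ∧ b.2 = edgeFlowSwap (Equiv.refl Bool) 0 (κ r).succ y
                  then (1 : ℝ) else 0)
              + (1 - α r x - α r y + min (α r x) (α r y)) * (if b.1 = x ∧ b.2 = y then (1 : ℝ) else 0))) * Φ b
          + ∑ b : (Fin (K + 1) → Bool) × (Fin (K + 1) → Bool), (∑ k : Fin (K + 1), ((1 - t) * w k) *
            (if x k = y k ∨ k = 0 then
                ∑ v : Bool, M k (x k) v * (if b.1 = update x k v ∧ b.2 = update y k v then (1 : ℝ) else 0)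
              else coordKernel M k x b.1 * coordKernel M k y b.2)) * Φ b := by
      rw [← Finset.sum_add_distrib]
      refine sum_congr rfl fun b _ => ?_
      rw [hQ, ← add_mul]
      congr 2
      rw [Finset.mul_sum]
      exact sum_congr rfl fun k _ => by ring
    rw [hsplit, sum_mixture_mul, sum_mixture_mul]
    congr 1
    exact sum_congr rfl fun r _ => by rw [syncSwap_sum_potential]
  rw [hexp]
  -- bound the two parts
  have hswap : ∀ r : Fin m, Sw r ≤ Φ (x, y) + (if x 0 = y 0
      then -((1 - θ) * a * (if x (κ r).succ = y (κ r).succ then (0 : ℝ) else 1))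
      else (1 - θ) * (if x (κ r).succ = y (κ r).succ then (1 : ℝ) else 0)) :=
    fun r => syncSwap_potential_le κ hμ hθ0.le hθ1 hα ha hΦ r x y
  have hupd : ∀ k : Fin (K + 1), Up k ≤ Φ (x, y) - (if k = 0 then θ * (if x 0 = y 0 then (0 : ℝ) else 1) else 0) :=
    fun k => syncUpdate_sum_potential_le hM hΦ k x y
  have h2 : ∑ k : Fin (K + 1), ((1 - t) * w k) * Up k
      ≤ (1 - t) * Φ (x, y) - (1 - t) * w 0 * θ * (if x 0 = y 0 then (0 : ℝ) else 1) := by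
    calc ∑ k : Fin (K + 1), ((1 - t) * w k) * Up k
        ≤ ∑ k : Fin (K + 1), ((1 - t) * w k) * (Φ (x, y) - (if k = 0 then θ * (if x 0 = y 0 then (0 : ℝ) else 1) else 0)) :=
          sum_le_sum fun k _ => mul_le_mul_of_nonneg_left (hupd k) (mul_nonneg (by linarith) (hw0 k))
      _ = (1 - t) * Φ (x, y) - (1 - t) * w 0 * θ * (if x 0 = y 0 then (0 : ℝ) else 1) := by
          simp_rw [mul_sub, Finset.sum_sub_distrib]
          rw [show ∑ k : Fin (K + 1), (1 - t) * w k * Φ (x, y) = (1 - t) * Φ (x, y) by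
            rw [← Finset.sum_mul, ← Finset.mul_sum, hw1, mul_one]]
          rw [Finset.sum_eq_single (0 : Fin (K + 1)) (fun k _ hk => by rw [if_neg hk, mul_zero])
            (fun h => absurd (mem_univ _) h), if_pos rfl]
          ring
  have htsum : ∑ _r : Fin m, t / m * Φ (x, y) = t * Φ (x, y) := by
    rw [sum_const, card_univ, Fintype.card_fin, nsmul_eq_mul]; field_simp
  by_cases h0 : x 0 = y 0
  · -- hubs agree: the cold disagreements are pushed to the hub
    rw [if_pos h0, mul_zero, sub_zero] at h2
    rw [if_pos h0, mul_zero, zero_add] at hhub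
    have hcnt := sum_entries_disagree_ge κ hc x y
    have h1 : ∑ r : Fin m, t / m * Sw r
        ≤ t * Φ (x, y) - t / m * ((1 - θ) * a) * ∑ r : Fin m, (if x (κ r).succ = y (κ r).succ then (0 : ℝ) else 1) := by
      calc ∑ r : Fin m, t / m * Sw r
          ≤ ∑ r : Fin m, (t / m * Φ (x, y) - t / m * ((1 - θ) * a) * (if x (κ r).succ = y (κ r).succ then (0 : ℝ) else 1)) :=
            sum_le_sum fun r _ => by
              have h := hswap r
              rw [if_pos h0] at h
              have := mul_le_mul_of_nonneg_left h (show (0 : ℝ) ≤ t / m by positivity)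
              linarith
        _ = t * Φ (x, y) - t / m * ((1 - θ) * a) * ∑ r : Fin m, (if x (κ r).succ = y (κ r).succ then (0 : ℝ) else 1) := by
            rw [Finset.sum_sub_distrib, htsum, ← Finset.mul_sum]
    have hD : (1 - θ) * a * c * t / m * Φ (x, y)
        ≤ t / m * ((1 - θ) * a) * ∑ r : Fin m, (if x (κ r).succ = y (κ r).succ then (0 : ℝ) else 1) := by
      have h := mul_le_mul_of_nonneg_left hcnt (show (0 : ℝ) ≤ (1 - θ) * a * (t / m) by positivity)
      calc (1 - θ) * a * c * t / m * Φ (x, y) = (1 - θ) * a * (t / m) * (c * Φ (x, y)) := by ring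
        _ = (1 - θ) * a * (t / m) * (c * ∑ j : Fin K, (if x j.succ = y j.succ then (0 : ℝ) else 1)) := by rw [← hhub]
        _ ≤ (1 - θ) * a * (t / m) * ∑ r : Fin m, (if x (κ r).succ = y (κ r).succ then (0 : ℝ) else 1) := h
        _ = t / m * ((1 - θ) * a) * ∑ r : Fin m, (if x (κ r).succ = y (κ r).succ then (0 : ℝ) else 1) := by ring
    have hmin : lam ≤ (1 - θ) * a * c * t / m := min_le_left _ _
    have hlamΦ : lam * Φ (x, y) ≤ (1 - θ) * a * c * t / m * Φ (x, y) := mul_le_mul_of_nonneg_right hmin hΦ0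
    linarith [h1, h2, hD, hlamΦ]
  · -- hubs differ: the hub disagreement escapes at rate `≤ t`, dies at rate `(1−t)w_0`
    rw [if_neg h0, mul_one] at h2
    have h1 : ∑ r : Fin m, t / m * Sw r ≤ t * Φ (x, y) + t * (1 - θ) := by
      calc ∑ r : Fin m, t / m * Sw r ≤ ∑ _r : Fin m, (t / m * Φ (x, y) + t / m * (1 - θ)) :=
            sum_le_sum fun r _ => by
              have h := hswap r
              rw [if_neg h0] at h
              have hb : (1 - θ) * (if x (κ r).succ = y (κ r).succ then (1 : ℝ) else 0) ≤ 1 - θ := by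
                split_ifs
                · rw [mul_one]
                · rw [mul_zero]; linarith
              have := mul_le_mul_of_nonneg_left (h.trans (by linarith [hb] : Φ (x, y) + (1 - θ)
                * (if x (κ r).succ = y (κ r).succ then (1 : ℝ) else 0) ≤ Φ (x, y) + (1 - θ)))
                (show (0 : ℝ) ≤ t / m by positivity)
              linarith
        _ = t * Φ (x, y) + t * (1 - θ) := by
            rw [Finset.sum_add_distrib, htsum, sum_const, card_univ, Fintype.card_fin, nsmul_eq_mul]
            field_simp
    have hmin : lam ≤ ((1 - t) * w 0 * θ - (1 - θ) * t) / (K + θ) := min_le_right _ _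
    have hKθ : (0 : ℝ) < K + θ := by positivity
    have hlamK : lam * Φ (x, y) ≤ (1 - t) * w 0 * θ - (1 - θ) * t := by
      calc lam * Φ (x, y) ≤ lam * (θ + K) := mul_le_mul_of_nonneg_left hΦK hlam0
        _ ≤ ((1 - t) * w 0 * θ - (1 - θ) * t) / (K + θ) * (θ + K) := mul_le_mul_of_nonneg_right hmin (by positivity)
        _ = (1 - t) * w 0 * θ - (1 - θ) * t := by field_simp; ring
    linarith [h1, h2, hlamK]

end Step

end Summit.Ventures.LatticeQCDFlow.Scaling

end
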